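import Summits.CriticalPhenomena.PercolationContinuityZ3.Theorems.PercNearOneGluingNoHeavyLowerTailSahiGridPatternRoutingCertForms

/-!
# `NoHeavyLowerTail` (crux stmt-CriticalPhenomena-4575), Sahi programme P1: **ROUTING CERTIFICATES, PART 2 — the atom dictionary, a kernel-checkable
# certificate checker with soundness in every dimension, and THEOREM BA₀ for the non-product top-cube set `↑{12,21} ⊆ [3]²`**

Support file (Sahi cell, seat `prim-sahi-p1`, generation 30; `--supports stmt-CriticalPhenomena-4575`).  Executable bookkeeping definitions + proofs; no `sorry`,
no `native_decide`; standard axioms.  Vocabulary of `…SahiGridPatternRoutingCertForms` (the symbols `n_a, n_b, ℓ`, `routeEv`, `routeListForm`, usage / plan forms).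

THE MATHEMATICS (memo FROM-prim-sahi-p1-gen29-BLOCK-STEPS §3.2; census W120).  ATOMS (`routeAtomUnitsI`, point indices lexicographic): kind `3`:
`κ_a(ξ,η') − κ_a(ξ,η)` (`η ≤ η'`, `κ_a = n_a − ℓ`); `4`: `κ_b(ξ',η) − κ_b(ξ,η)` (`ξ ≤ ξ'`); `8, 9, 10`: second differences of `n_a, n_b, ℓ` over a rectangle
`(ξ,η) ≤ (ξ',η')` — each evaluates to a number `≥ 0` for EVERY `k` and all up-sets `V, P, Q` (`routeEv_atom_nonneg`).  A DIAGONAL ROUTING CERTIFICATE of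
`S ⊆ [3]^n` is a list of weighted atoms `(w, K, a, b, c, d)` with  `D·(2^n Σ_{ξ∈S}(n_a+n_b−ℓ)(ξ,ξ) − usage_S) = Σ w·atom`  as formal forms; **`routeDiagCheck`**
decides this on point indices (plus index bounds, order side conditions, and a left-inverse test of the point coding), and
**`theta_blockAnd_le_diag_of_check`** (SOUNDNESS) turns a passing check into the routing inequality (R) `Θ_{S×V}(P×Q) ≤ 2^n Σ_{ξ∈S} Θ_V(P^ξ×Q^ξ)` for every
`k` and all up-sets `V, P, Q`.  Condition (H) of `…DiagCertBlockAndRouting` is automatic for the diagonal plan (`routeH_diag`), hence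
**`diagCert_blockAnd_N_of_diagRouteCheck`**: (N) for `d' = 2^n·1_S ⊗ d` on `S × V` for every `V` with a certificate `d ≥ 0`, and
**`sStarD_blockAnd_cylSet_nonneg_of_diagRouteCheck`**: `[3]^m × (S×V)` is a good first slot of the pattern functional for every `m` (given (T) for `d'`,
which is `…DiagCertBlockAndT.diagCert_blockAnd_T`).  INSTANCE, kernel `decide` on the census certificate W120 §3b D_000001011 (96 atoms, scale 2):
`S = ↑{12,21} = {12,21,22} ⊆ [3]²`, the only NON-PRODUCT up-set of the top cube `{1,2}²` — **`diagCert_blockAnd_N_up12or21`**, **`sStarD_blockAnd_up12or21_nonneg`**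
(THEOREM BA₀(↑{12,21}): the first block-AND step that is neither a literal step nor a cylinder lift; the product sets are iterated literal steps).  The same
checker accepts the census certificates of all 19 up-sets of `{1,2}³` (to be replayed in companion files).  Nothing here asserts `PatternPos d` for `d ≥ 4`. [this work]
-/

namespace Summit.CriticalPhenomena.PercolationContinuityZ3.Theorems.SahiGridPattern

open Finset SahiGrid3
open scoped BigOperators

variable {n k : ℕ}

/-! ### The atom dictionary (point indices are lexicographic, first coordinate most significant) -/

/-- The point of `[3]^n` with lexicographic index `i`. [this work] -/
def routePt (n i : ℕ) : Pd n := fun a => ⟨i / 3 ^ (n - 1 - (a : ℕ)) % 3, Nat.mod_lt _ (by norm_num)⟩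

/-- A lexicographic code of a point (only its left-inverse property on `[0, 3^n)`, tested by the checker, is ever used). [this work] -/
def routeCode (ξ : Pd n) : ℕ := (List.finRange n).foldl (fun acc t => 3 * acc + (ξ t : ℕ)) 0

/-- All points of `[3]^n`, by index. [this work] -/
def routePts (n : ℕ) : List (Pd n) := (List.range (3 ^ n)).map (routePt n)

/-- Boolean test of the product order on `[3]^n`. [this work] -/
def routeLe (p q : Pd n) : Bool := decide (∀ t : Fin n, p t ≤ q t)

/-- `routeLe` decides the product order. [this work] -/
theorem le_of_routeLe {p q : Pd n} (h : routeLe p q = true) : p ≤ q := by unfold routeLe at h; rw [decide_eq_true_iff] at h; exact fun t => h t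

/-- The UNIT LIST (on point INDICES, entries `(coefficient, kind, first index, second index)`) of the atom `(K; a, b, c, d)`:
`K = 3`: `κ_a(a,c) − κ_a(a,b)` (`b ≤ c`; `κ_a = n_a − ℓ`);  `K = 4`: `κ_b(c,b) − κ_b(a,b)` (`a ≤ c`);  `K = 8, 9, 10`: the second difference
`f(c,d) − f(a,d) − f(c,b) + f(a,b)` of `f = n_a, n_b, ℓ` (`a ≤ c`, `b ≤ d`).  (Kinds `0–2`, `5–7` of the census dictionary — plain atoms and first
differences — never occur in the certificates and are not implemented.) [this work] -/
def routeAtomUnitsI (K a b c d : ℕ) : List (ℤ × ℕ × ℕ × ℕ) :=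
  if K = 3 then [(1, 0, a, c), (-1, 2, a, c), (-1, 0, a, b), (1, 2, a, b)]
  else if K = 4 then [(1, 1, c, b), (-1, 2, c, b), (-1, 1, a, b), (1, 2, a, b)]
  else if (8 ≤ K ∧ K ≤ 10) then [(1, K - 8, c, d), (-1, K - 8, a, d), (-1, K - 8, c, b), (1, K - 8, a, b)]
  else []

/-- Decoding an index unit list to points. [this work] -/
def routeDecode (n : ℕ) (L : List (ℤ × ℕ × ℕ × ℕ)) : List (ℤ × ℕ × Pd n × Pd n) := L.map fun u => (u.1, u.2.1, routePt n u.2.2.1, routePt n u.2.2.2)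

/-- Validity of an atom: indices below `3^n`, an implemented kind, and the order side conditions. [this work] -/
def routeAtomValid (n K a b c d : ℕ) : Bool :=
  decide (a < 3 ^ n) && decide (b < 3 ^ n) && decide (c < 3 ^ n) && decide (d < 3 ^ n) &&
  (if K = 3 then routeLe (routePt n b) (routePt n c) else if K = 4 then routeLe (routePt n a) (routePt n c)
   else if (8 ≤ K ∧ K ≤ 10) then routeLe (routePt n a) (routePt n c) && routeLe (routePt n b) (routePt n d) else false)

/-- **Every valid atom evaluates to a nonnegative number**, for every `k` and all up-sets `V, P, Q`. [this work] -/
theorem routeEv_atom_nonneg {V : Finset (Pd k)} (hV : IsUpperSet (V : Set (Pd k))) {P Q : Finset (Pd (n + k))} (hP : IsUpperSet (P : Set (Pd (n + k))))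
    (hQ : IsUpperSet (Q : Set (Pd (n + k)))) {K a b c d : ℕ} (hv : routeAtomValid n K a b c d = true) :
    0 ≤ routeEv V P Q (routeListForm (routeDecode n (routeAtomUnitsI K a b c d))) := by
  rw [routeEv_listForm]; unfold routeAtomValid at hv; simp only [Bool.and_eq_true, decide_eq_true_eq] at hv; obtain ⟨-, hv⟩ := hv
  by_cases hK3 : K = 3
  · subst hK3; rw [if_pos rfl] at hv
    simp [routeAtomUnitsI, routeDecode, routeSym]
    linarith [routeKapA_mono hV hP hQ (routePt n a) (le_of_routeLe hv)]
  · rw [if_neg hK3] at hv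
    by_cases hK4 : K = 4
    · subst hK4; rw [if_pos rfl] at hv
      simp [routeAtomUnitsI, routeDecode, routeSym]
      linarith [routeKapB_mono hV hP hQ (le_of_routeLe hv) (routePt n b)]
    · rw [if_neg hK4] at hv
      by_cases hK : 8 ≤ K ∧ K ≤ 10
      · rw [if_pos hK, Bool.and_eq_true] at hv
        have h1 := le_of_routeLe hv.1; have h2 := le_of_routeLe hv.2; obtain ⟨hK8, hK10⟩ := hK; interval_cases K
        · simp [routeAtomUnitsI, routeDecode, routeSym]; linarith [routeSymW_d2_nonneg hP hQ (routeWA_nonneg V) h1 h2]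
        · simp [routeAtomUnitsI, routeDecode, routeSym]; linarith [routeSymW_d2_nonneg hP hQ (routeWB_nonneg V) h1 h2]
        · simp [routeAtomUnitsI, routeDecode, routeSym]; linarith [routeSymW_d2_nonneg hP hQ (routeWL_nonneg V) h1 h2]
      · rw [if_neg hK] at hv; exact absurd hv (by decide)

/-- The indices of a valid atom's units are below `3^n`. [this work] -/
theorem routeAtomUnitsI_lt {K a b c d : ℕ} (hv : routeAtomValid n K a b c d = true) : ∀ u ∈ routeAtomUnitsI K a b c d, u.2.2.1 < 3 ^ n ∧ u.2.2.2 < 3 ^ n := by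
  unfold routeAtomValid at hv; simp only [Bool.and_eq_true, decide_eq_true_eq] at hv; obtain ⟨⟨⟨⟨ha, hb⟩, hc⟩, hd⟩, -⟩ := hv
  intro u hu; unfold routeAtomUnitsI at hu
  split_ifs at hu <;> simp only [List.mem_cons, List.not_mem_nil, or_false] at hu <;> rcases hu with rfl | rfl | rfl | rfl <;> simp [ha, hb, hc, hd]

/-! ### Certificates, the checker, soundness -/

/-- The index unit list of a certificate (a list of weighted atoms `(w, K, a, b, c, d)`). [this work] -/
def routeCertUnitsI (cert : List (ℕ × ℕ × ℕ × ℕ × ℕ × ℕ)) : List (ℤ × ℕ × ℕ × ℕ) :=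
  cert.flatMap fun e => (routeAtomUnitsI e.2.1 e.2.2.1 e.2.2.2.1 e.2.2.2.2.1 e.2.2.2.2.2).map fun u => ((e.1 : ℤ) * u.1, u.2)

/-- The index version of the formal form of a unit list, at the cell with indices `(a, b)`. [this work] -/
def routeListFormI (L : List (ℤ × ℕ × ℕ × ℕ)) (i a b : ℕ) : ℤ := (L.map fun u => if (i = u.2.1 ∧ a = u.2.2.1 ∧ b = u.2.2.2) then u.1 else 0).sum

/-- Unit lists: concatenation adds the forms. [this work] -/
theorem routeListForm_append (L1 L2 : List (ℤ × ℕ × Pd n × Pd n)) (i : ℕ) (ξ η : Pd n) :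
    routeListForm (L1 ++ L2) i ξ η = routeListForm L1 i ξ η + routeListForm L2 i ξ η := by unfold routeListForm; rw [List.map_append, List.sum_append]

/-- Unit lists: scaling the coefficients scales the form. [this work] -/
theorem routeListForm_scale (w : ℤ) (L : List (ℤ × ℕ × ℕ × ℕ)) (i : ℕ) (ξ η : Pd n) :
    routeListForm (routeDecode n (L.map fun u => (w * u.1, u.2))) i ξ η = w * routeListForm (routeDecode n L) i ξ η := by
  unfold routeListForm routeDecode
  induction L with
  | nil => simp
  | cons u L ih => simp only [List.map_cons, List.sum_cons] at ih ⊢; rw [ih]; split_ifs <;> ring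

/-- **A certificate with valid atoms evaluates to a nonnegative number** (every `k`, all up-sets `V, P, Q`). [this work] -/
theorem routeEv_cert_nonneg {V : Finset (Pd k)} (hV : IsUpperSet (V : Set (Pd k))) {P Q : Finset (Pd (n + k))} (hP : IsUpperSet (P : Set (Pd (n + k))))
    (hQ : IsUpperSet (Q : Set (Pd (n + k)))) (cert : List (ℕ × ℕ × ℕ × ℕ × ℕ × ℕ))
    (hvalid : ∀ e ∈ cert, routeAtomValid n e.2.1 e.2.2.1 e.2.2.2.1 e.2.2.2.2.1 e.2.2.2.2.2 = true) :
    0 ≤ routeEv V P Q (routeListForm (routeDecode n (routeCertUnitsI cert))) := by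
  induction cert with
  | nil => rw [routeEv_listForm]; simp [routeCertUnitsI, routeDecode]
  | cons e rest ih =>
    have hsplit : routeEv V P Q (routeListForm (routeDecode n (routeCertUnitsI (e :: rest)))) =
        routeEv V P Q (fun i ξ η => (e.1 : ℤ) * routeListForm (routeDecode n (routeAtomUnitsI e.2.1 e.2.2.1 e.2.2.2.1 e.2.2.2.2.1 e.2.2.2.2.2)) i ξ η +
          routeListForm (routeDecode n (routeCertUnitsI rest)) i ξ η) := by
      refine routeEv_congr fun i ξ η => ?_
      unfold routeCertUnitsI
      rw [List.flatMap_cons, ← routeListForm_scale, ← routeListForm_append]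
      unfold routeDecode; rw [List.map_append]
    rw [hsplit, routeEv_add, routeEv_smul]
    exact add_nonneg (mul_nonneg (by exact_mod_cast Nat.zero_le _) (routeEv_atom_nonneg hV hP hQ (hvalid e List.mem_cons_self)))
      (ih (fun e' he' => hvalid e' (List.mem_cons_of_mem _ he')))

/-- Index units of a certificate with valid atoms have indices below `3^n`. [this work] -/
theorem routeCertUnitsI_lt {cert : List (ℕ × ℕ × ℕ × ℕ × ℕ × ℕ)} (hvalid : ∀ e ∈ cert, routeAtomValid n e.2.1 e.2.2.1 e.2.2.2.1 e.2.2.2.2.1 e.2.2.2.2.2 = true) :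
    ∀ u ∈ routeCertUnitsI cert, u.2.2.1 < 3 ^ n ∧ u.2.2.2 < 3 ^ n := by
  intro u hu; unfold routeCertUnitsI at hu; rw [List.mem_flatMap] at hu
  obtain ⟨e, he, hu⟩ := hu; rw [List.mem_map] at hu; obtain ⟨u', hu', rfl⟩ := hu
  exact routeAtomUnitsI_lt (hvalid e he) u' hu'

/-- **Index forms agree with point forms** at decoded cells, given the left-inverse property of `routeCode` below `3^n`. [this work] -/
theorem routeListForm_decode_eq {L : List (ℤ × ℕ × ℕ × ℕ)} (hL : ∀ u ∈ L, u.2.2.1 < 3 ^ n ∧ u.2.2.2 < 3 ^ n)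
    (hcode : ∀ x, x < 3 ^ n → routeCode (routePt n x) = x) {a b : ℕ} (ha : a < 3 ^ n) (hb : b < 3 ^ n) (i : ℕ) :
    routeListForm (routeDecode n L) i (routePt n a) (routePt n b) = routeListFormI L i a b := by
  have hinj : ∀ x y, x < 3 ^ n → y < 3 ^ n → (routePt n x = routePt n y ↔ x = y) := by
    intro x y hx hy; refine ⟨fun h => ?_, fun h => by rw [h]⟩
    have := congrArg routeCode h; rwa [hcode x hx, hcode y hy] at this
  unfold routeListForm routeListFormI routeDecode
  induction L with
  | nil => simp
  | cons u L ih =>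
    have hu := hL u List.mem_cons_self
    have ih' := ih (fun v hv => hL v (List.mem_cons_of_mem _ hv))
    simp only [List.map_cons, List.sum_cons] at ih' ⊢
    rw [ih']; simp only [hinj a u.2.2.1 ha hu.1, hinj b u.2.2.2 hb hu.2]

/-- Units with a different first index do not contribute at the cells `(a, ·)`. [this work] -/
theorem routeListFormI_filter (L : List (ℤ × ℕ × ℕ × ℕ)) (i a b : ℕ) :
    routeListFormI (L.filter fun u => u.2.2.1 == a) i a b = routeListFormI L i a b := by
  unfold routeListFormI
  induction L with
  | nil => rfl
  | cons u L ih =>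
    rw [List.map_cons, List.sum_cons]
    by_cases h : u.2.2.1 = a
    · have hb : (u.2.2.1 == a) = true := beq_iff_eq.2 h
      simp only [List.filter_cons, hb, if_true, List.map_cons, List.sum_cons, ih]
    · have hb : (u.2.2.1 == a) = false := beq_eq_false_iff_ne.2 h
      have hz : (if (i = u.2.1 ∧ a = u.2.2.1 ∧ b = u.2.2.2) then u.1 else 0) = 0 := if_neg (fun hh => h hh.2.1.symm)
      simp only [List.filter_cons, hb, Bool.false_eq_true, if_false, hz, zero_add, ih]

/-- The cells `(a, b)`, `b < 3^n`, of one row against the units with first index `a`. [this work] -/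
def routeRowCheck (n : ℕ) (sb : Pd n → Bool) (D : ℕ) (a : ℕ) (Ua : List (ℤ × ℕ × ℕ × ℕ)) : Bool :=
  (List.range (3 ^ n)).all fun b => [0, 1, 2].all fun i =>
    ((D : ℤ) * (routePlanDiagB n sb i (routePt n a) (routePt n b) - routeUsageB sb i (routePt n a) (routePt n b)) == routeListFormI Ua i a b)

/-- The rows listed in `rows`, each against the units bucketed by first index. [this work] -/
def routeRowsCheck (n : ℕ) (sb : Pd n → Bool) (D : ℕ) (cert : List (ℕ × ℕ × ℕ × ℕ × ℕ × ℕ)) (rows : List ℕ) : Bool :=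
  rows.all fun a => routeRowCheck n sb D a ((routeCertUnitsI cert).filter fun u => u.2.2.1 == a)

/-- The data tests: left inverse of the point coding below `3^n`, and validity of every atom. [this work] -/
def routePreCheck (n : ℕ) (cert : List (ℕ × ℕ × ℕ × ℕ × ℕ × ℕ)) : Bool :=
  ((List.range (3 ^ n)).all fun a => routeCode (routePt n a) == a) && (cert.all fun e => routeAtomValid n e.2.1 e.2.2.1 e.2.2.2.1 e.2.2.2.2.1 e.2.2.2.2.2)

/-- **THE CHECKER for a DIAGONAL routing certificate** of `S` (membership function `sb`): the data tests and the formal identity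
`D·(plan − usage) = Σ w·atom` at every kind `0,1,2` and every index cell `(a,b)`, row by row. [this work] -/
def routeDiagCheck (n : ℕ) (sb : Pd n → Bool) (D : ℕ) (cert : List (ℕ × ℕ × ℕ × ℕ × ℕ × ℕ)) : Bool :=
  routePreCheck n cert && routeRowsCheck n sb D cert (List.range (3 ^ n))

/-- Rows may be checked in chunks (keeps each kernel evaluation small). [this work] -/
theorem routeRowsCheck_append (n : ℕ) (sb : Pd n → Bool) (D : ℕ) (cert : List (ℕ × ℕ × ℕ × ℕ × ℕ × ℕ)) (r₁ r₂ : List ℕ) :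
    routeRowsCheck n sb D cert (r₁ ++ r₂) = (routeRowsCheck n sb D cert r₁ && routeRowsCheck n sb D cert r₂) := by
  unfold routeRowsCheck; rw [List.all_append]

/-- The 27 rows of `[3]³` in three chunks. [this work] -/
theorem routeRange27_split : List.range 27 = List.range' 0 9 ++ (List.range' 9 9 ++ List.range' 18 9) := by decide

/-- Assembling a dimension-3 check from its four kernel-evaluated parts. [this work] -/
theorem routeDiagCheck_three_of_parts {sb : Pd 3 → Bool} {D : ℕ} {cert : List (ℕ × ℕ × ℕ × ℕ × ℕ × ℕ)} (h0 : routePreCheck 3 cert = true)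
    (h1 : routeRowsCheck 3 sb D cert (List.range' 0 9) = true) (h2 : routeRowsCheck 3 sb D cert (List.range' 9 9) = true)
    (h3 : routeRowsCheck 3 sb D cert (List.range' 18 9) = true) : routeDiagCheck 3 sb D cert = true := by
  unfold routeDiagCheck
  rw [show (3:ℕ) ^ 3 = 27 by norm_num, routeRange27_split, routeRowsCheck_append, routeRowsCheck_append, h0, h1, h2, h3]
  rfl

/-- **SOUNDNESS OF THE CHECKER (the routing inequality (R) for the diagonal plan; every `k`).**  If `routeDiagCheck n sb D cert = true` with `D > 0`, `sb`
the membership function of `S`, and `routePts n` exhausts `[3]^n`, then for `A = S × V` and all up-sets `V ⊆ [3]^k`, `P, Q ⊆ [3]^{n+k}`: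
`Θ_A(P×Q) ≤ Σ_ξ Σ_η [ξ=η]·2^n·1_S(ξ) · Θ_V(P^ξ × Q^η)`. [this work] -/
theorem theta_blockAnd_le_diag_of_check {S : Finset (Pd n)} {sb : Pd n → Bool} (hsb : ∀ ξ, sb ξ = true ↔ ξ ∈ S) (hpts : ∀ x : Pd n, x ∈ routePts n)
    {D : ℕ} (hD : 0 < D) {cert : List (ℕ × ℕ × ℕ × ℕ × ℕ × ℕ)} (hc : routeDiagCheck n sb D cert = true) {V : Finset (Pd k)}
    (hV : IsUpperSet (V : Set (Pd k))) {A : Finset (Pd (n + k))} (hA : ∀ ξ z, glue ξ z ∈ A ↔ (ξ ∈ S ∧ z ∈ V)) {P Q : Finset (Pd (n + k))}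
    (hP : IsUpperSet (P : Set (Pd (n + k)))) (hQ : IsUpperSet (Q : Set (Pd (n + k)))) : (∑ x ∈ P, ∑ y ∈ Q, thetaVal A x y) ≤
      ∑ ξ : Pd n, ∑ η : Pd n, (if ξ = η then (2:ℤ) ^ n * ind S ξ else 0) * ∑ q ∈ sect P ξ, ∑ r ∈ sect Q η, thetaVal V q r := by
  unfold routeDiagCheck routePreCheck routeRowsCheck at hc
  rw [Bool.and_eq_true, Bool.and_eq_true, List.all_eq_true, List.all_eq_true, List.all_eq_true] at hc
  obtain ⟨⟨hcode, hval⟩, hid⟩ := hc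
  have hcode' : ∀ x, x < 3 ^ n → routeCode (routePt n x) = x := fun x hx => eq_of_beq (hcode x (List.mem_range.2 hx))
  have hvalid : ∀ e ∈ cert, routeAtomValid n e.2.1 e.2.2.1 e.2.2.2.1 e.2.2.2.2.1 e.2.2.2.2.2 = true := fun e he => hval e he
  have hdec : ∀ ξ : Pd n, ∃ a, a < 3 ^ n ∧ routePt n a = ξ := by
    intro ξ; have h := hpts ξ; unfold routePts at h; rw [List.mem_map] at h
    obtain ⟨a, ha, h⟩ := h; exact ⟨a, List.mem_range.1 ha, h⟩
  have hcell : ∀ i, i < 3 → ∀ ξ η : Pd n,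
      (D : ℤ) * (routePlanDiagB n sb i ξ η - routeUsageB sb i ξ η) = routeListForm (routeDecode n (routeCertUnitsI cert)) i ξ η := by
    intro i hi ξ η
    obtain ⟨a, ha, rfl⟩ := hdec ξ
    obtain ⟨b, hb, rfl⟩ := hdec η
    have h1 := hid a (List.mem_range.2 ha); unfold routeRowCheck at h1; rw [List.all_eq_true] at h1
    have h2 := h1 b (List.mem_range.2 hb); rw [List.all_eq_true] at h2
    have hi' : i ∈ [0, 1, 2] := by
      have : i = 0 ∨ i = 1 ∨ i = 2 := by omega
      rcases this with rfl | rfl | rfl <;> simp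
    rw [eq_of_beq (h2 i hi'), routeListFormI_filter]
    exact (routeListForm_decode_eq (routeCertUnitsI_lt hvalid) hcode' ha hb i).symm
  have hev : (D : ℤ) * (routeEv V P Q (routePlanDiagB n sb) - routeEv V P Q (routeUsageB sb)) =
      routeEv V P Q (routeListForm (routeDecode n (routeCertUnitsI cert))) := by
    rw [← routeEv_sub, ← routeEv_smul]; exact routeEv_congr3 hcell
  have hpos := routeEv_cert_nonneg hV hP hQ cert hvalid; rw [← hev] at hpos
  have hD' : (0 : ℤ) < (D : ℤ) := by exact_mod_cast hD
  have hle : routeEv V P Q (routeUsageB sb) ≤ routeEv V P Q (routePlanDiagB n sb) := by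
    have h0 := (mul_nonneg_iff_of_pos_left hD').1 hpos
    linarith
  rw [routeEv_usage hA hsb, routeEv_planDiag hsb] at hle; exact hle

/-- **Condition (H) is automatic for the diagonal plan** `μ(ξ,η) = [ξ=η]·2^n·1_S(ξ)` (it holds with equality). [this work] -/
theorem routeH_diag (S X X' : Finset (Pd n)) : (∑ ξ : Pd n, ∑ η : Pd n, (if ξ = η then (2:ℤ) ^ n * ind S ξ else 0) * (ind X ξ * ind X' η)) ≤
    (2:ℤ) ^ n * ∑ ξ : Pd n, ind S ξ * ind X ξ * ind X' ξ := by
  have h : ∀ ξ : Pd n, (∑ η : Pd n, (if ξ = η then (2:ℤ) ^ n * ind S ξ else 0) * (ind X ξ * ind X' η)) = (2:ℤ) ^ n * (ind S ξ * ind X ξ * ind X' ξ) := by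
    intro ξ
    have e : ∀ η : Pd n, (if ξ = η then (2:ℤ) ^ n * ind S ξ else 0) * (ind X ξ * ind X' η) =
        if ξ = η then (2:ℤ) ^ n * (ind S ξ * ind X ξ * ind X' ξ) else 0 := by
      intro η; split_ifs with hh
      · rw [← hh]; ring
      · ring
    simp only [e, Finset.sum_ite_eq, Finset.mem_univ, if_true]
  simp only [h, ← Finset.mul_sum]; exact le_rfl

/-- The diagonal plan is nonnegative. [this work] -/
theorem routeDiag_nonneg (S : Finset (Pd n)) (ξ η : Pd n) : (0:ℤ) ≤ (if ξ = η then (2:ℤ) ^ n * ind S ξ else 0) := by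
  split_ifs; exacts [mul_nonneg (pow_nonneg (by norm_num) n) (ind_nonneg' S ξ), le_rfl]

/-- **THEOREM (certificate level; every `k`).**  A passing diagonal routing certificate for `S ⊆ [3]^n` and a vector `d ≥ 0` with (N) for an up-set
`V ⊆ [3]^k` make `d' = 2^n·1_S ⊗ d` satisfy (N) for `A = S × V`:  `Θ_A(P×Q) ≤ Σ_{x∈P∩Q} 2^n·1_S(freeOf x)·d(cellOf x)` for all up-sets `P, Q`.  (With (T) for
`V, d` and `S` an up-set, `…DiagCertBlockAndT.diagCert_blockAnd_T` supplies (T) for `A, d'`: so `d'` is a diagonal certificate of `S × V`.) [this work] -/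
theorem diagCert_blockAnd_N_of_diagRouteCheck {S : Finset (Pd n)} {sb : Pd n → Bool} (hsb : ∀ ξ, sb ξ = true ↔ ξ ∈ S) (hpts : ∀ x : Pd n, x ∈ routePts n)
    {D : ℕ} (hD : 0 < D) {cert : List (ℕ × ℕ × ℕ × ℕ × ℕ × ℕ)} (hc : routeDiagCheck n sb D cert = true) {V : Finset (Pd k)}
    (hV : IsUpperSet (V : Set (Pd k))) {A : Finset (Pd (n + k))} (hA : ∀ ξ z, glue ξ z ∈ A ↔ (ξ ∈ S ∧ z ∈ V)) (d : Pd k → ℤ) (hd : ∀ q, 0 ≤ d q)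
    (hN : ∀ X X' : Finset (Pd k), IsUpperSet (X : Set (Pd k)) → IsUpperSet (X' : Set (Pd k)) → (∑ q ∈ X, ∑ r ∈ X', thetaVal V q r) ≤ ∑ q ∈ X ∩ X', d q)
    {P Q : Finset (Pd (n + k))} (hP : IsUpperSet (P : Set (Pd (n + k)))) (hQ : IsUpperSet (Q : Set (Pd (n + k)))) :
    (∑ x ∈ P, ∑ y ∈ Q, thetaVal A x y) ≤ ∑ x ∈ P ∩ Q, (2:ℤ) ^ n * ind S (freeOf x) * d (cellOf x) :=
  diagCert_blockAnd_N_of_routing hA d hd hN (fun ξ η => if ξ = η then (2:ℤ) ^ n * ind S ξ else 0) (routeDiag_nonneg S)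
    (fun X X' _ _ => routeH_diag S X X') (fun _ _ hP' hQ' => theta_blockAnd_le_diag_of_check hsb hpts hD hc hV hA hP' hQ') hP hQ

/-- **THEOREM BA₀(S) from a passing diagonal routing certificate (every `k`, every `m`).**  With, in addition, (T) for `d'` on `A` (hypothesis `hT'`; this is
`…DiagCertBlockAndT.diagCert_blockAnd_T`, valid for every up-set `S` and every `d` with (T) for `V`): `[3]^m × (S × V)` is a good first slot of the pattern
functional — `0 ≤ sStarD ([3]^m × A) B C` for all up-sets `B, C`. [this work] -/
theorem sStarD_blockAnd_cylSet_nonneg_of_diagRouteCheck {m : ℕ} {S : Finset (Pd n)} {sb : Pd n → Bool} (hsb : ∀ ξ, sb ξ = true ↔ ξ ∈ S)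
    (hpts : ∀ x : Pd n, x ∈ routePts n) {D : ℕ} (hD : 0 < D) {cert : List (ℕ × ℕ × ℕ × ℕ × ℕ × ℕ)} (hc : routeDiagCheck n sb D cert = true)
    {V : Finset (Pd k)} (hV : IsUpperSet (V : Set (Pd k))) {A : Finset (Pd (n + k))} (hA : ∀ ξ z, glue ξ z ∈ A ↔ (ξ ∈ S ∧ z ∈ V)) (d : Pd k → ℤ)
    (hd : ∀ q, 0 ≤ d q) (hN : ∀ X X' : Finset (Pd k), IsUpperSet (X : Set (Pd k)) → IsUpperSet (X' : Set (Pd k)) →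
      (∑ q ∈ X, ∑ r ∈ X', thetaVal V q r) ≤ ∑ q ∈ X ∩ X', d q)
    (hT' : ∀ W : Finset (Pd (n + k)), IsUpperSet (W : Set (Pd (n + k))) → (∑ x ∈ W, (2:ℤ) ^ n * ind S (freeOf x) * d (cellOf x)) ≤ ∑ x ∈ W, lamU A x)
    {B C : Finset (Pd (m + (n + k)))} (hB : IsUpperSet (B : Set (Pd (m + (n + k))))) (hC : IsUpperSet (C : Set (Pd (m + (n + k))))) :
    0 ≤ sStarD (cylSet A : Finset (Pd (m + (n + k)))) B C :=
  sStarD_blockAnd_cylSet_nonneg_of_routing hA d hd hN (fun ξ η => if ξ = η then (2:ℤ) ^ n * ind S ξ else 0) (routeDiag_nonneg S)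
    (fun X X' _ _ => routeH_diag S X X') (fun _ _ hP' hQ' => theta_blockAnd_le_diag_of_check hsb hpts hD hc hV hA hP' hQ') hT' hB hC

/-! ### Up-sets by generators and the completeness of `routePts 3` (data interface for the instance files) -/

/-- Membership in the up-set generated by `gens`. [this work] -/
def routeUpB (gens : List (Pd n)) (x : Pd n) : Bool := gens.any fun g => routeLe g x

/-- The up-set generated by `gens`. [this work] -/
def routeUp (gens : List (Pd n)) : Finset (Pd n) := Finset.univ.filter fun x => routeUpB gens x = true

/-- `routeUpB` is the membership function of `routeUp`. [this work] -/
theorem routeUpB_iff (gens : List (Pd n)) (x : Pd n) : routeUpB gens x = true ↔ x ∈ routeUp gens := by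
  unfold routeUp; rw [Finset.mem_filter]; simp

/-- `routeUp gens` is an up-set. [this work] -/
theorem isUpperSet_routeUp (gens : List (Pd n)) : IsUpperSet ((routeUp gens : Finset (Pd n)) : Set (Pd n)) := by
  intro x y hxy hx
  rw [Finset.mem_coe, ← routeUpB_iff] at hx ⊢
  unfold routeUpB at hx ⊢
  rw [List.any_eq_true] at hx ⊢
  obtain ⟨g, hg, hgx⟩ := hx
  refine ⟨g, hg, ?_⟩
  unfold routeLe at hgx ⊢
  rw [decide_eq_true_iff] at hgx ⊢
  exact fun t => le_trans (hgx t) (hxy t)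

/-- `routePts 3` lists every point of `[3]³`. [this work] -/
theorem routePts_three_complete : ∀ x : Pd 3, x ∈ routePts 3 := by decide

/-! ### Instance (kernel `decide`): the non-product top-cube up-set `↑{12,21} = {12, 21, 22} ⊆ [3]²` -/

/-- Membership function of `↑{12,21} ⊆ [3]²`: `(x₀ ≥ 1 ∧ x₁ ≥ 2) ∨ (x₀ ≥ 2 ∧ x₁ ≥ 1)`. [this work] -/
def sbUp12or21 (x : Pd 2) : Bool := (decide (1 ≤ (x 0 : ℕ)) && decide (2 ≤ (x 1 : ℕ))) || (decide (2 ≤ (x 0 : ℕ)) && decide (1 ≤ (x 1 : ℕ)))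

/-- The up-set `↑{12,21} = {12, 21, 22}` of `[3]²` — Θ-Harris, inside the top cube `{1,2}²`, and NOT a product of one-dimensional up-sets. [this work] -/
def up12or21 : Finset (Pd 2) := Finset.univ.filter fun x => sbUp12or21 x = true

/-- `sbUp12or21` is the membership function of `up12or21`. [this work] -/
theorem sbUp12or21_iff (x : Pd 2) : sbUp12or21 x = true ↔ x ∈ up12or21 := by unfold up12or21; rw [Finset.mem_filter]; simp

/-- `↑{12,21}` is an up-set. [this work] -/
theorem isUpperSet_up12or21 : IsUpperSet ((up12or21 : Finset (Pd 2)) : Set (Pd 2)) := by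
  intro x y hxy hx
  rw [Finset.mem_coe, ← sbUp12or21_iff] at hx ⊢
  have h0 : (x 0 : ℕ) ≤ (y 0 : ℕ) := Fin.le_iff_val_le_val.1 (hxy 0)
  have h1 : (x 1 : ℕ) ≤ (y 1 : ℕ) := Fin.le_iff_val_le_val.1 (hxy 1)
  unfold sbUp12or21 at hx ⊢
  simp only [Bool.or_eq_true, Bool.and_eq_true, decide_eq_true_eq] at hx ⊢
  omega

/-- `routePts 2` lists every point of `[3]²`. [this work] -/
theorem routePts_two_complete : ∀ x : Pd 2, x ∈ routePts 2 := by decide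

/-- The diagonal routing certificate of `↑{12,21}` (census W120 §3b, D_000001011; 96 weighted atoms `(w, K, a, b, c, d)`, scale `D = 2`; only the
κ-monotonicity kinds `3, 4` and the second differences `8, 9, 10` occur). [this work] -/
def certUp12or21 : List (ℕ × ℕ × ℕ × ℕ × ℕ × ℕ) :=
[
  (2, 10, 0, 4, 1, 7), (1, 10, 0, 7, 1, 8), (1, 10, 0, 7, 3, 8), (1, 10, 1, 3, 2, 4), (1, 10, 1, 3, 4, 4), (1, 10, 1, 4, 4, 7), (2, 10, 1, 6, 2, 7), (2, 10, 1, 7, 4, 8),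
  (1, 10, 2, 3, 5, 4), (2, 10, 2, 3, 5, 6), (1, 10, 3, 1, 4, 2), (1, 10, 3, 1, 4, 4), (1, 10, 3, 2, 4, 5), (2, 10, 3, 2, 6, 5), (1, 10, 3, 4, 6, 7), (1, 10, 3, 5, 6, 8),
  (2, 10, 4, 0, 7, 1), (1, 10, 4, 1, 7, 4), (1, 10, 4, 3, 7, 6), (2, 10, 4, 5, 7, 8), (1, 10, 5, 3, 8, 6), (2, 10, 5, 4, 8, 7), (1, 10, 5, 6, 8, 7), (2, 10, 6, 1, 7, 2),
  (1, 10, 6, 5, 7, 8), (1, 10, 7, 0, 8, 1), (1, 10, 7, 0, 8, 3), (2, 10, 7, 1, 8, 4), (1, 8, 1, 4, 4, 5), (1, 8, 1, 7, 4, 8), (2, 8, 2, 6, 5, 7), (1, 8, 4, 1, 5, 4),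
  (1, 8, 4, 1, 7, 4), (3, 8, 4, 4, 5, 5), (1, 8, 4, 7, 5, 8), (2, 8, 5, 3, 8, 4), (3, 8, 5, 4, 8, 7), (1, 8, 5, 5, 8, 8), (2, 8, 6, 2, 7, 5), (1, 8, 6, 4, 7, 7),
  (1, 8, 7, 4, 8, 5), (3, 8, 7, 7, 8, 8), (1, 9, 1, 4, 4, 5), (1, 9, 1, 4, 4, 7), (2, 9, 2, 6, 5, 7), (2, 9, 3, 5, 4, 8), (1, 9, 4, 1, 5, 4), (3, 9, 4, 4, 5, 5),
  (3, 9, 4, 5, 7, 8), (1, 9, 4, 6, 7, 7), (1, 9, 4, 7, 5, 8), (1, 9, 5, 5, 8, 8), (2, 9, 6, 2, 7, 5), (1, 9, 7, 1, 8, 4), (1, 9, 7, 4, 8, 5), (3, 9, 7, 7, 8, 8),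
  (1, 3, 1, 4, 5, 0), (1, 3, 1, 7, 8, 0), (2, 3, 2, 6, 7, 0), (2, 3, 4, 1, 4, 0), (2, 3, 4, 4, 5, 0), (2, 3, 5, 0, 3, 0), (1, 3, 5, 1, 4, 0), (4, 3, 5, 3, 4, 0),
  (4, 3, 5, 4, 5, 0), (2, 3, 6, 2, 5, 0), (1, 3, 6, 4, 7, 0), (2, 3, 7, 0, 1, 0), (1, 3, 7, 1, 4, 0), (2, 3, 7, 3, 4, 0), (4, 3, 7, 4, 7, 0), (3, 3, 7, 5, 8, 0),
  (2, 3, 8, 0, 1, 0), (4, 3, 8, 1, 2, 0), (4, 3, 8, 2, 5, 0), (4, 3, 8, 5, 8, 0), (2, 4, 0, 7, 1, 0), (2, 4, 0, 8, 1, 0), (2, 4, 0, 5, 3, 0), (4, 4, 1, 8, 2, 0),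
  (2, 4, 1, 4, 4, 0), (1, 4, 1, 5, 4, 0), (1, 4, 1, 7, 4, 0), (2, 4, 2, 6, 5, 0), (4, 4, 2, 8, 5, 0), (4, 4, 3, 5, 4, 0), (2, 4, 3, 7, 4, 0), (1, 4, 4, 1, 5, 0),
  (2, 4, 4, 4, 5, 0), (4, 4, 4, 5, 5, 0), (1, 4, 4, 6, 7, 0), (4, 4, 4, 7, 7, 0), (3, 4, 5, 7, 8, 0), (4, 4, 5, 8, 8, 0), (2, 4, 6, 2, 7, 0), (1, 4, 7, 1, 8, 0)]

set_option maxRecDepth 20000 in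
set_option maxHeartbeats 20000000 in
/-- The certificate passes the checker (kernel evaluation, `decide +kernel`). [this work] -/
theorem routeDiagCheck_up12or21 : routeDiagCheck 2 sbUp12or21 2 certUp12or21 = true := by decide +kernel

/-- **THEOREM BA₀(↑{12,21}), certificate level (every `k`).**  For every up-set `V ⊆ [3]^k` and every `d ≥ 0` with (N) for `V`, the vector `d' = 4·1_S ⊗ d`
satisfies (N) for `A = ↑{12,21} × V`. [this work] -/
theorem diagCert_blockAnd_N_up12or21 {V : Finset (Pd k)} (hV : IsUpperSet (V : Set (Pd k))) {A : Finset (Pd (2 + k))}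
    (hA : ∀ ξ z, glue ξ z ∈ A ↔ (ξ ∈ up12or21 ∧ z ∈ V)) (d : Pd k → ℤ) (hd : ∀ q, 0 ≤ d q)
    (hN : ∀ X X' : Finset (Pd k), IsUpperSet (X : Set (Pd k)) → IsUpperSet (X' : Set (Pd k)) → (∑ q ∈ X, ∑ r ∈ X', thetaVal V q r) ≤ ∑ q ∈ X ∩ X', d q)
    {P Q : Finset (Pd (2 + k))} (hP : IsUpperSet (P : Set (Pd (2 + k)))) (hQ : IsUpperSet (Q : Set (Pd (2 + k)))) :
    (∑ x ∈ P, ∑ y ∈ Q, thetaVal A x y) ≤ ∑ x ∈ P ∩ Q, (2:ℤ) ^ 2 * ind up12or21 (freeOf x) * d (cellOf x) :=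
  diagCert_blockAnd_N_of_diagRouteCheck sbUp12or21_iff routePts_two_complete (by norm_num) routeDiagCheck_up12or21 hV hA d hd hN hP hQ

/-- **THEOREM BA₀(↑{12,21}) (every `k`, every `m`).**  For every diagonally certified up-set `V ⊆ [3]^k` (`d ≥ 0` with (N); (T) for `d' = 4·1_S ⊗ d` is
`…DiagCertBlockAndT.diagCert_blockAnd_T` applied to (T) for `d`), the block product `↑{12,21} × V` is a good first slot of the pattern functional in every
dimension: `0 ≤ sStarD ([3]^m × (↑{12,21} × V)) B C` for all up-sets `B, C` — the first block-AND step with a NON-PRODUCT S-block. [this work] -/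
theorem sStarD_blockAnd_up12or21_nonneg {m : ℕ} {V : Finset (Pd k)} (hV : IsUpperSet (V : Set (Pd k))) {A : Finset (Pd (2 + k))}
    (hA : ∀ ξ z, glue ξ z ∈ A ↔ (ξ ∈ up12or21 ∧ z ∈ V)) (d : Pd k → ℤ) (hd : ∀ q, 0 ≤ d q)
    (hN : ∀ X X' : Finset (Pd k), IsUpperSet (X : Set (Pd k)) → IsUpperSet (X' : Set (Pd k)) → (∑ q ∈ X, ∑ r ∈ X', thetaVal V q r) ≤ ∑ q ∈ X ∩ X', d q)
    (hT' : ∀ W : Finset (Pd (2 + k)), IsUpperSet (W : Set (Pd (2 + k))) → (∑ x ∈ W, (2:ℤ) ^ 2 * ind up12or21 (freeOf x) * d (cellOf x)) ≤ ∑ x ∈ W, lamU A x)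
    {B C : Finset (Pd (m + (2 + k)))} (hB : IsUpperSet (B : Set (Pd (m + (2 + k))))) (hC : IsUpperSet (C : Set (Pd (m + (2 + k))))) :
    0 ≤ sStarD (cylSet A : Finset (Pd (m + (2 + k)))) B C :=
  sStarD_blockAnd_cylSet_nonneg_of_diagRouteCheck sbUp12or21_iff routePts_two_complete (by norm_num) routeDiagCheck_up12or21 hV hA d hd hN hT' hB hC

end Summit.CriticalPhenomena.PercolationContinuityZ3.Theorems.SahiGridPattern
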